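import Summits.BirchSwinnertonDyer.BirchSwinnertonDyer.Theorems.PrintCFramBottomClassIndexLawFiveLeHerbrandOddVanishing
import Summits.BirchSwinnertonDyer.BirchSwinnertonDyer.Theorems.PrintCFramBottomClassIndexLawFiveLeHerbrandStickelbergerHerbrandDirection
import HarnessLib

/-!
# Stub O (the ODD vanishing) WITHOUT Mazur–Wiles: the hMW-free twins of the odd class-group chain

Crux `stmt-BirchSwinnertonDyer-20372` (`PrintCFram.BottomClassIndexLawFiveLe`), line `eisenstein-resource-bdp-line` (registry v13/v14). The
(KL) branch of the composition calls `HerbrandOddClassGroup.oddVanish_range_final_of_teichmuller hMW …` (w6 g0), whose chain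
(`oddVanish_range_final` → `absGaloisHom_eq_one_final` → `classGroupHom_eq_one_final[_of_units]` → `linearMap_classGroup_modP_eq_zero_final`
→ `iInf_eigenspace_classGroup_modP_eq_bot[_final]` → `classGroup_eigen_mod_mem_smul`) uses the named fact Mazur–Wiles Thm. 2 ONLY at its
bottom, through `classGroupChiComponent_eq_bot_of_norm_bernoulli_eq_one hMW` — the Herbrand direction, now an UNCONDITIONAL kernel theorem
(`HerbrandStickelberger.classGroupChiComponent_eq_bot_of_norm_bernoulli_eq_one_unconditional`, p664994: Stickelberger's theorem for `ℚ(μ_f)`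
+ the tree's class field theory). THIS FILE re-runs the chain on that theorem: every statement below is the corresponding theorem of
`…HerbrandOddClassGroup{Quotient,ModP,Final,Hom}.lean` / `…HerbrandOddVanishing.lean` with the hypothesis
`(hMW : MazurWiles1984.thm2_*)` DELETED and nothing else changed (proofs verbatim up to the callee names); plus the passage from the named
fact's «`χ ≠ ω`» clause (`¬ (f = p ∧ …)`) to the pointwise reading (`¬ ∀ a, …`) for primitive `χ` (`not_forall_norm_sub_lt_one_of_not_teichmuller`).
Top: **`oddVanish_range_final_of_teichmuller_unconditional`** — STUB O of the registered composition with NO named fact.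

No definition, no named fact, no `sorry`. BSD is not proved by any of this; no summit statement is proved here.
References: as in the originals — [Lang1990] Ch. 1 §3; [Washington1997] §6.3, Thm. 10.1; [NeukirchANT1999] VI (7.1); [Solomon1990] §I.
-/

noncomputable section

open NumberField Field IsDedekindDomain Module Module.End
open Literature.NumberTheory.GaloisRepresentations Literature.NumberTheory.NumberFields
open Literature.NumberTheory.EllipticCurves Literature.NumberTheory.LFunctions
open Literature.RepresentationTheory.FiniteGroups
open Summit.BirchSwinnertonDyer.BirchSwinnertonDyer.Theorems.PrintCFram.HerbrandSelmerToHom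
open scoped TensorProduct

set_option linter.dupNamespace false
set_option autoImplicit false

namespace Summit.BirchSwinnertonDyer.BirchSwinnertonDyer.Theorems.PrintCFram.HerbrandOddClassGroup

variable {p : ℕ} [Fact p.Prime]

/-! ## §0 «`χ ≠ ω`»: from the named fact's clause to the pointwise reading, for primitive `χ` -/

/-- For `p` odd and `χ` PRIMITIVE of conductor `f`: the clause `¬ (f = p ∧ ∀ a, p ∤ a → ‖χ(a) − a‖_p < 1)` of the Mazur–Wiles typing
implies the pointwise reading `¬ ∀ a, p ∤ a → ‖χ(a) − a‖_p < 1` (for `p ∤ f` this is w6's `not_forall_norm_sub_lt_one_of_not_dvd`; for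
`p ∣ f ≠ p` primitivity gives a unit `u ≡ 1 (mod p)` with `χ(u) ≠ 1`, and `χ(u) ≢ 1 ≡ ũ`). [cite: Washington1997, §5.1 (the Teichmüller character)]
[cite: Lang1990, Ch. 1 §3 Lemma 1] -/
theorem not_forall_norm_sub_lt_one_of_not_teichmuller (hp2 : p ≠ 2) {f : ℕ} [NeZero f] (χ : DirichletCharacter ℚ_[p] f)
    (hprim : χ.IsPrimitive) (hω : ¬ (f = p ∧ ∀ a : ℤ, ¬ ((p : ℤ) ∣ a) → ‖χ (a : ZMod f) - (a : ℚ_[p])‖ < 1)) :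
    ¬ ∀ a : ℤ, ¬ ((p : ℤ) ∣ a) → ‖χ (a : ZMod f) - (a : ℚ_[p])‖ < 1 := by
  have hp : p.Prime := Fact.out
  by_cases hpf : p ∣ f
  · by_cases hfp : f = p
    · exact fun h => hω ⟨hfp, h⟩
    · intro hall
      have hnf : ¬ χ.FactorsThrough p := by
        intro h
        have h1 : χ.conductor ≤ p := Nat.sInf_le ((DirichletCharacter.mem_conductorSet_iff χ).mpr h)
        rw [hprim] at h1
        exact hfp (le_antisymm h1 (Nat.le_of_dvd (Nat.pos_of_ne_zero (NeZero.ne f)) hpf))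
      rw [DirichletCharacter.factorsThrough_iff_ker_unitsMap hpf] at hnf
      simp only [SetLike.le_def, MonoidHom.mem_ker, not_forall] at hnf
      obtain ⟨u, hu1, huχ⟩ := hnf
      have huχ' : χ (u : ZMod f) ≠ 1 := by
        intro h
        apply huχ
        ext
        rw [MulChar.coe_toUnitHom, h, Units.val_one]
      have hu1' : (((u : ZMod f).val : ℕ) : ZMod p) = 1 := by
        have h := congrArg (fun x : (ZMod p)ˣ => (x : ZMod p)) hu1
        simp only [ZMod.unitsMap_def, Units.coe_map, MonoidHom.coe_coe, Units.val_one] at h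
        rwa [ZMod.castHom_apply, ZMod.cast_eq_val] at h
      have hpa : ¬ ((p : ℤ) ∣ (((u : ZMod f).val : ℕ) : ℤ)) := by
        intro hd
        have h0 : ((((u : ZMod f).val : ℕ) : ℤ) : ZMod p) = 0 := (ZMod.intCast_zmod_eq_zero_iff_dvd _ p).mpr hd
        rw [Int.cast_natCast, hu1'] at h0
        exact one_ne_zero h0
      have hlt := hall _ hpa
      rw [Int.cast_natCast, ZMod.natCast_zmod_val, Int.cast_natCast] at hlt
      have hval : ‖(((u : ZMod f).val : ℕ) : ℚ_[p]) - 1‖ < 1 := by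
        have h : (((u : ZMod f).val : ℕ) : ℚ_[p]) - 1 = ((((u : ZMod f).val : ℤ) - 1 : ℤ) : ℚ_[p]) := by
          push_cast; ring
        rw [h, Padic.norm_intCast_lt_one_iff, ← ZMod.intCast_zmod_eq_zero_iff_dvd]
        push_cast
        rw [hu1', sub_self]
      have hχ1 : ‖χ (u : ZMod f) - 1‖ = 1 := by
        have h := HerbrandStickelberger.norm_apply_sub_apply_eq_one hp2 χ u 1 (by rwa [Units.val_one, map_one])
        rwa [Units.val_one, map_one] at h
      have hrw : χ (u : ZMod f) - (((u : ZMod f).val : ℕ) : ℚ_[p]) =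
          (χ (u : ZMod f) - 1) + (-((((u : ZMod f).val : ℕ) : ℚ_[p]) - 1)) := by ring
      have hne : ‖χ (u : ZMod f) - 1‖ ≠ ‖-((((u : ZMod f).val : ℕ) : ℚ_[p]) - 1)‖ := by
        rw [norm_neg, hχ1]; exact (ne_of_lt hval).symm
      rw [hrw, Padic.add_eq_max_of_ne hne, hχ1, norm_neg, max_eq_left hval.le] at hlt
      exact lt_irrefl _ hlt
  · exact not_forall_norm_sub_lt_one_of_not_dvd hp2 χ hpf

/-! ## §1 The class-group chain (Quotient → ModP → Final) without `hMW` -/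

section ClassGroup

variable {K : Type} [Field K] [NumberField K] [IsAbelianGalois ℚ K]

/-- `classGroup_eigen_mod_mem_smul` WITHOUT Mazur–Wiles (same statement minus `hMW`; bottom = the unconditional Herbrand direction).
[cite: Lang1990, Ch. 1 §3 Cor. 3] -/
theorem classGroup_eigen_mod_mem_smul_unconditional (hp2 : p ≠ 2)
    (hpK : ¬ p ∣ Module.finrank ℚ K)
    {f : ℕ} [NeZero f] {χ : DirichletCharacter ℚ_[p] f} (hprim : χ.IsPrimitive) (hodd : χ.Odd)
    (hχω : ¬ ∀ a : ℤ, ¬ ((p : ℤ) ∣ a) → ‖χ (a : ZMod f) - (a : ℚ_[p])‖ < 1)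
    {ψ : (K ≃ₐ[ℚ] K) →* ℤ_[p]ˣ}
    (hψχ : ∀ τ : absoluteGaloisGroup ℚ,
      (((ψ (absGaloisQuot ℚ K τ) : ℤ_[p]ˣ) : ℤ_[p]) : ℚ_[p]) =
        χ ((modNCyclotomicCharacter ℚ f τ : (ZMod f)ˣ) : ZMod f))
    (hB : ‖KrizLi2019.bernoulliOnePrim χ⁻¹‖ = 1)
    (θ : (K ≃ₐ[ℚ] K) →* (ZMod p)ˣ)
    (hθ : ∀ σ : K ≃ₐ[ℚ] K, PadicInt.toZMod ((ψ σ : ℤ_[p]ˣ) : ℤ_[p]) = ((θ σ : (ZMod p)ˣ) : ZMod p))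
    {x : Additive (ClassGroup (𝓞 K))}
    (hx : ∀ σ : K ≃ₐ[ℚ] K, ∃ w : Additive (ClassGroup (𝓞 K)),
      classGroupRep ℚ K σ x = (((θ σ : (ZMod p)ˣ) : ZMod p).val : ℤ) • x + (p : ℤ) • w) :
    ∃ y : Additive (ClassGroup (𝓞 K)), x = (p : ℤ) • y := by
  have hbot := HerbrandStickelberger.classGroupChiComponent_eq_bot_of_norm_bernoulli_eq_one_unconditional hp2 hpK
    hprim hodd hχω hψχ hB
  exact exists_eq_smul_of_eigen_mod_of_chiComponent_eq_bot (classGroupRep ℚ K)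
    (isUnit_card_gal_of_not_dvd hpK) ψ hbot (fun σ => ((((θ σ : (ZMod p)ˣ) : ZMod p).val : ℕ) : ℤ))
    (dvd_val_sub_of_toZMod_eq ψ θ hθ) hx

/-- `iInf_eigenspace_classGroup_modP_eq_bot` WITHOUT Mazur–Wiles. [cite: Washington1997, §6.3] [cite: Lang1990, Ch. 1 §3 Cor. 3] -/
theorem iInf_eigenspace_classGroup_modP_eq_bot_unconditional (hp2 : p ≠ 2)
    (hpK : ¬ p ∣ Module.finrank ℚ K)
    {f : ℕ} [NeZero f] {χ : DirichletCharacter ℚ_[p] f} (hprim : χ.IsPrimitive) (hodd : χ.Odd)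
    (hχω : ¬ ∀ a : ℤ, ¬ ((p : ℤ) ∣ a) → ‖χ (a : ZMod f) - (a : ℚ_[p])‖ < 1)
    {ψ : (K ≃ₐ[ℚ] K) →* ℤ_[p]ˣ}
    (hψχ : ∀ τ : absoluteGaloisGroup ℚ,
      (((ψ (absGaloisQuot ℚ K τ) : ℤ_[p]ˣ) : ℤ_[p]) : ℚ_[p]) =
        χ ((modNCyclotomicCharacter ℚ f τ : (ZMod f)ˣ) : ZMod f))
    (hB : ‖KrizLi2019.bernoulliOnePrim χ⁻¹‖ = 1)
    (θ : (K ≃ₐ[ℚ] K) →* (ZMod p)ˣ)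
    (hθ : ∀ σ : K ≃ₐ[ℚ] K, PadicInt.toZMod ((ψ σ : ℤ_[p]ˣ) : ℤ_[p]) = ((θ σ : (ZMod p)ˣ) : ZMod p)) :
    (⨅ σ : K ≃ₐ[ℚ] K, eigenspace (baseChangeRep (ZMod p) (classGroupRep ℚ K) σ) ((θ σ : (ZMod p)ˣ) : ZMod p)) = ⊥ :=
  iInf_eigenspace_baseChangeRep_eq_bot_of_forall (classGroupRep ℚ K) θ fun _ hx =>
    classGroup_eigen_mod_mem_smul_unconditional hp2 hpK hprim hodd hχω hψχ hB θ hθ hx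

end ClassGroup

section Final

variable {L : Type} [Field L] [NumberField L] [IsAbelianGalois ℚ L]

/-- `iInf_eigenspace_classGroup_modP_eq_bot_final` WITHOUT Mazur–Wiles (routed through the pointwise chain; «`χ ≠ ω`» from
`‖B_{1,χ⁻¹}‖ = 1` via w3 g4 and §0). [cite: Washington1997, §6.3] [cite: Lang1990, Ch. 1 §3 Cor. 3] -/
theorem iInf_eigenspace_classGroup_modP_eq_bot_final_unconditional (hp2 : p ≠ 2)
    (hpL : ¬ p ∣ Module.finrank ℚ L)
    {f : ℕ} [NeZero f] {χ : DirichletCharacter ℚ_[p] f} (hprim : χ.IsPrimitive) (hodd : χ.Odd)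
    (φ : absoluteGaloisGroup ℚ →* ℤ_[p]ˣ)
    (hφχ : ∀ τ : absoluteGaloisGroup ℚ,
      (((φ τ : ℤ_[p]ˣ) : ℤ_[p]) : ℚ_[p]) = χ ((modNCyclotomicCharacter ℚ f τ : (ZMod f)ˣ) : ZMod f))
    (hB : ‖KrizLi2019.bernoulliOnePrim χ⁻¹‖ = 1)
    (ψ : (L ≃ₐ[ℚ] L) →* ℤ_[p]ˣ) (hψ : ∀ τ : absoluteGaloisGroup ℚ, ψ (absGaloisQuot ℚ L τ) = φ τ)
    (θ : (L ≃ₐ[ℚ] L) →* (ZMod p)ˣ)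
    (hθ : ∀ σ : L ≃ₐ[ℚ] L, PadicInt.toZMod ((ψ σ : ℤ_[p]ˣ) : ℤ_[p]) = ((θ σ : (ZMod p)ˣ) : ZMod p)) :
    (⨅ σ : L ≃ₐ[ℚ] L, eigenspace (baseChangeRep (ZMod p) (classGroupRep ℚ L) σ) ((θ σ : (ZMod p)ˣ) : ZMod p)) = ⊥ := by
  have hgen : ‖(generalizedBernoulli 1 χ⁻¹ : ℚ_[p])‖ = 1 := by
    rw [← bernoulliOnePrim_inv_eq_generalizedBernoulli hprim]; exact hB
  have hω := BernoulliUnits.not_isTeichmuller_of_norm_generalizedBernoulli_inv_le_one hp2 χ hgen.le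
  have hχω := not_forall_norm_sub_lt_one_of_not_teichmuller hp2 χ hprim hω
  have hψχ : ∀ τ : absoluteGaloisGroup ℚ,
      (((ψ (absGaloisQuot ℚ L τ) : ℤ_[p]ˣ) : ℤ_[p]) : ℚ_[p]) = χ ((modNCyclotomicCharacter ℚ f τ : (ZMod f)ˣ) : ZMod f) :=
    fun τ => by rw [hψ τ]; exact hφχ τ
  exact iInf_eigenspace_classGroup_modP_eq_bot_unconditional hp2 hpL hprim hodd hχω hψχ hB θ hθ

/-- `linearMap_classGroup_modP_eq_zero_final` WITHOUT Mazur–Wiles (F1ᵈ as an unconditional theorem). [cite: Washington1997, §6.3] -/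
theorem linearMap_classGroup_modP_eq_zero_final_unconditional (hp2 : p ≠ 2)
    (hpL : ¬ p ∣ Module.finrank ℚ L)
    {f : ℕ} [NeZero f] {χ : DirichletCharacter ℚ_[p] f} (hprim : χ.IsPrimitive) (hodd : χ.Odd)
    (φ : absoluteGaloisGroup ℚ →* ℤ_[p]ˣ)
    (hφχ : ∀ τ : absoluteGaloisGroup ℚ,
      (((φ τ : ℤ_[p]ˣ) : ℤ_[p]) : ℚ_[p]) = χ ((modNCyclotomicCharacter ℚ f τ : (ZMod f)ˣ) : ZMod f))
    (hB : ‖KrizLi2019.bernoulliOnePrim χ⁻¹‖ = 1)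
    (ψ : (L ≃ₐ[ℚ] L) →* ℤ_[p]ˣ) (hψ : ∀ τ : absoluteGaloisGroup ℚ, ψ (absGaloisQuot ℚ L τ) = φ τ)
    (θ : (L ≃ₐ[ℚ] L) →* (ZMod p)ˣ)
    (hθ : ∀ σ : L ≃ₐ[ℚ] L, PadicInt.toZMod ((ψ σ : ℤ_[p]ˣ) : ℤ_[p]) = ((θ σ : (ZMod p)ˣ) : ZMod p))
    {W : Type*} [AddCommGroup W] [Module (ZMod p) W]
    (F : ZMod p ⊗[ℤ] Additive (ClassGroup (𝓞 L)) →ₗ[ZMod p] W)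
    (hF : ∀ (σ : L ≃ₐ[ℚ] L) (ξ : ZMod p ⊗[ℤ] Additive (ClassGroup (𝓞 L))),
      F (baseChangeRep (ZMod p) (classGroupRep ℚ L) σ ξ) = ((θ σ : (ZMod p)ˣ) : ZMod p) • F ξ) :
    F = 0 := by
  haveI : Invertible (Fintype.card (L ≃ₐ[ℚ] L) : ZMod p) := (isUnit_card_gal_zmod hpL).invertible
  exact HerbrandEigenspace.eq_zero_of_equivariant_of_iInf_eigenspace_eq_bot _ θ
    (iInf_eigenspace_classGroup_modP_eq_bot_final_unconditional hp2 hpL hprim hodd φ hφχ hB ψ hψ θ hθ) F hF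

/-! ## §2 The Hom chain without `hMW` -/

/-- `classGroupHom_eq_one_final` WITHOUT Mazur–Wiles. [cite: Washington1997, §6.3] -/
theorem classGroupHom_eq_one_final_unconditional (hp2 : p ≠ 2)
    (hpL : ¬ p ∣ Module.finrank ℚ L)
    {f : ℕ} [NeZero f] {χ : DirichletCharacter ℚ_[p] f} (hprim : χ.IsPrimitive) (hodd : χ.Odd)
    (φ : absoluteGaloisGroup ℚ →* ℤ_[p]ˣ)
    (hφL : ∀ σ : absoluteGaloisGroup L, φ (absGaloisRestrict ℚ L σ) = 1)
    (hφχ : ∀ τ : absoluteGaloisGroup ℚ,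
      (((φ τ : ℤ_[p]ˣ) : ℤ_[p]) : ℚ_[p]) = χ ((modNCyclotomicCharacter ℚ f τ : (ZMod f)ˣ) : ZMod f))
    (hB : ‖KrizLi2019.bernoulliOnePrim χ⁻¹‖ = 1)
    (g : ClassGroup (𝓞 L) →* Multiplicative (ZMod p))
    (hg : ∀ (τ : absoluteGaloisGroup ℚ) (c : ClassGroup (𝓞 L)),
      g (ClassGroup.mulEquiv (AmbiguousClass.intAut (absGaloisQuot ℚ L τ)) c) =
        g c ^ (PadicInt.toZMod ((φ τ : ℤ_[p]ˣ) : ℤ_[p])).val) :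
    g = 1 := by
  obtain ⟨ψ, hψ⟩ := exists_factor_absGaloisQuot ℚ L φ hφL
  let θ : (L ≃ₐ[ℚ] L) →* (ZMod p)ˣ := (Units.map (PadicInt.toZMod (p := p)).toMonoidHom).comp ψ
  have hθ : ∀ σ : L ≃ₐ[ℚ] L, PadicInt.toZMod ((ψ σ : ℤ_[p]ˣ) : ℤ_[p]) = ((θ σ : (ZMod p)ˣ) : ZMod p) :=
    fun σ => rfl
  refine classGroupHom_eq_one_of_forall_linearMap_eq_zero θ
    (fun F hF => linearMap_classGroup_modP_eq_zero_final_unconditional hp2 hpL hprim hodd φ hφχ hB ψ hψ θ hθ F hF) g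
    fun σ c => ?_
  obtain ⟨τ, rfl⟩ := absGaloisQuot_surjective ℚ L σ
  rw [hg τ, ← hθ, hψ τ]

/-- `classGroupHom_eq_one_final_of_units` WITHOUT Mazur–Wiles. [cite: Washington1997, §6.3] -/
theorem classGroupHom_eq_one_final_of_units_unconditional (hp2 : p ≠ 2)
    (hpL : ¬ p ∣ Module.finrank ℚ L)
    {f : ℕ} [NeZero f] {χ : DirichletCharacter ℚ_[p] f} (hprim : χ.IsPrimitive) (hodd : χ.Odd)
    (φ : absoluteGaloisGroup ℚ →* ℤ_[p]ˣ)
    (hφL : ∀ σ : absoluteGaloisGroup L, φ (absGaloisRestrict ℚ L σ) = 1)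
    (hφχ : ∀ τ : absoluteGaloisGroup ℚ,
      (((φ τ : ℤ_[p]ˣ) : ℤ_[p]) : ℚ_[p]) = χ ((modNCyclotomicCharacter ℚ f τ : (ZMod f)ˣ) : ZMod f))
    (hB : ‖KrizLi2019.bernoulliOnePrim χ⁻¹‖ = 1)
    (r : absoluteGaloisGroup ℚ →* (ZMod p)ˣ)
    (hr : ∀ τ : absoluteGaloisGroup ℚ, PadicInt.toZMod ((φ τ : ℤ_[p]ˣ) : ℤ_[p]) = ((r τ : (ZMod p)ˣ) : ZMod p))
    (g : ClassGroup (𝓞 L) →* Multiplicative (ZMod p))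
    (hg : ∀ (τ : absoluteGaloisGroup ℚ) (c : ClassGroup (𝓞 L)),
      g (ClassGroup.mulEquiv (AmbiguousClass.intAut (absGaloisQuot ℚ L τ)) c) = g c ^ ((r τ : (ZMod p)ˣ) : ZMod p).val) :
    g = 1 :=
  classGroupHom_eq_one_final_unconditional hp2 hpL hprim hodd φ hφL hφχ hB g fun τ c => by rw [hg τ c, hr τ]

/-- `absGaloisHom_eq_one_final` WITHOUT Mazur–Wiles (the `Γ_L`-level odd vanishing, unconditional).
[cite: NeukirchANT1999, Ch. VI §7 Thm. (7.1)] [cite: Washington1997, §6.3] -/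
theorem absGaloisHom_eq_one_final_unconditional (hp2 : p ≠ 2)
    (hpL : ¬ p ∣ Module.finrank ℚ L)
    {f : ℕ} [NeZero f] {χ : DirichletCharacter ℚ_[p] f} (hprim : χ.IsPrimitive) (hodd : χ.Odd)
    (φ : absoluteGaloisGroup ℚ →* ℤ_[p]ˣ)
    (hφL : ∀ σ : absoluteGaloisGroup L, φ (absGaloisRestrict ℚ L σ) = 1)
    (hφχ : ∀ τ : absoluteGaloisGroup ℚ,
      (((φ τ : ℤ_[p]ˣ) : ℤ_[p]) : ℚ_[p]) = χ ((modNCyclotomicCharacter ℚ f τ : (ZMod f)ˣ) : ZMod f))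
    (hB : ‖KrizLi2019.bernoulliOnePrim χ⁻¹‖ = 1)
    (r : absoluteGaloisGroup ℚ →* (ZMod p)ˣ)
    (hr : ∀ τ : absoluteGaloisGroup ℚ, PadicInt.toZMod ((φ τ : ℤ_[p]ˣ) : ℤ_[p]) = ((r τ : (ZMod p)ˣ) : ZMod p))
    (κ : absoluteGaloisGroup L →* Multiplicative (ZMod p)) (hκ : IsOpen (κ.ker : Set (absoluteGaloisGroup L)))
    (hunr : ∀ (v : HeightOneSpectrum (𝓞 L)) (𝔓 : Ideal (absIntegers (𝓞 L) L)), 𝔓 ∈ v.primesAbove →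
      ∀ g ∈ 𝔓.inertia (absoluteGaloisGroup L), κ g = 1)
    (heq : ∀ (γ : absoluteGaloisGroup ℚ) (σ : absoluteGaloisGroup L),
      κ (absGaloisOuterConj ℚ L γ σ) = (κ σ) ^ ((r γ : (ZMod p)ˣ) : ZMod p).val) :
    κ = 1 := by
  haveI : IsGalois ℚ L := IsAbelianGalois.toIsGalois
  obtain ⟨g, hg⟩ := exists_factor_classGroup_of_unramified_of_odd L (odd_natCard_multiplicative_zmod hp2) κ hκ hunr
  have hg1 : g = 1 := classGroupHom_eq_one_final_of_units_unconditional hp2 hpL hprim hodd φ hφL hφχ hB r hr g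
    fun τ c => classGroupHom_mulEquiv_eq_pow_val hg r heq τ c
  ext τ
  rw [hg τ, hg1, MonoidHom.one_apply, MonoidHom.one_apply]

/-! ## §3 Stub O without `hMW` -/

/-- **STUB O WITHOUT MAZUR–WILES** — `oddVanish_range_final` with the hypothesis `hMW` deleted: `ODD(r, range res_{ℚ,L})`
unconditionally. [cite: NeukirchANT1999, Ch. VI §7 Thm. (7.1) and Ch. I §9 (9.4)] [cite: Lang1990, Ch. 1 §3 Cor. 3] -/
theorem oddVanish_range_final_unconditional (hp2 : p ≠ 2)
    (hpL : ¬ p ∣ Module.finrank ℚ L)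
    {f : ℕ} [NeZero f] {χ : DirichletCharacter ℚ_[p] f} (hprim : χ.IsPrimitive) (hodd : χ.Odd)
    (φ : absoluteGaloisGroup ℚ →* ℤ_[p]ˣ)
    (hφL : ∀ σ : absoluteGaloisGroup L, φ (absGaloisRestrict ℚ L σ) = 1)
    (hφχ : ∀ τ : absoluteGaloisGroup ℚ,
      (((φ τ : ℤ_[p]ˣ) : ℤ_[p]) : ℚ_[p]) = χ ((modNCyclotomicCharacter ℚ f τ : (ZMod f)ˣ) : ZMod f))
    (hB : ‖KrizLi2019.bernoulliOnePrim χ⁻¹‖ = 1)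
    (r : absoluteGaloisGroup ℚ →* (ZMod p)ˣ)
    (hr : ∀ τ : absoluteGaloisGroup ℚ, PadicInt.toZMod ((φ τ : ℤ_[p]ˣ) : ℤ_[p]) = ((r τ : (ZMod p)ˣ) : ZMod p))
    (G : absoluteGaloisGroup ℚ → ZMod p)
    (hGc : Continuous fun n : (absGaloisRestrict ℚ L).range => G n)
    (hadd : ∀ a ∈ (absGaloisRestrict ℚ L).range, ∀ b ∈ (absGaloisRestrict ℚ L).range, G (a * b) = G a + G b)
    (hconj : ∀ g, ∀ n ∈ (absGaloisRestrict ℚ L).range, G (g * n * g⁻¹) = (r g : ZMod p) * G n)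
    (hI : ∀ (ℓ : HeightOneSpectrum (𝓞 ℚ)) (𝔓 : Ideal (absIntegers (𝓞 ℚ) ℚ)), 𝔓 ∈ ℓ.primesAbove →
      ∀ n ∈ (absGaloisRestrict ℚ L).range, n ∈ 𝔓.inertia (absoluteGaloisGroup ℚ) → G n = 0) :
    ∀ n ∈ (absGaloisRestrict ℚ L).range, G n = 0 :=
  haveI : NeZero p := ⟨(Fact.out : p.Prime).ne_zero⟩
  oddVanishQ_of_forall_character_field r
    (fun κ hκ heq hunr => absGaloisHom_eq_one_final_unconditional hp2 hpL hprim hodd φ hφL hφχ hB r hr κ hκ hunr heq)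
    G hGc hadd hconj hI

/-- **STUB O, Teichmüller form, WITHOUT MAZUR–WILES** — `oddVanish_range_final_of_teichmuller` with `hMW` deleted: the statement the
registered composition `EisensteinResourceBdpLine.BottomClassIndexLawFiveLe_of` feeds into the conjugation swap, now with NO named fact
behind it (Stickelberger + class field theory, both in the tree). [cite: Lang1990, Ch. 1 §3 Cor. 3] [cite: Washington1997, §5.1, §6.3] -/
theorem oddVanish_range_final_of_teichmuller_unconditional (hp2 : p ≠ 2)
    (hpL : ¬ p ∣ Module.finrank ℚ L)
    (r : absoluteGaloisGroup ℚ →* (ZMod p)ˣ) (hrL : ∀ σ : absoluteGaloisGroup L, r (absGaloisRestrict ℚ L σ) = 1)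
    {m : ℕ} [NeZero m] (ψ : DirichletCharacter ℚ_[p] m)
    (hψ : ∀ τ : absoluteGaloisGroup ℚ, ψ ((modNCyclotomicCharacter ℚ m τ : (ZMod m)ˣ) : ZMod m) =
      (((Kato2004.teichmullerChar p (r τ) : ℤ_[p]ˣ) : ℤ_[p]) : ℚ_[p]))
    (hodd : ψ.Odd) (hB : ‖KrizLi2019.bernoulliOnePrim ψ⁻¹‖ = 1)
    (G : absoluteGaloisGroup ℚ → ZMod p)
    (hGc : Continuous fun n : (absGaloisRestrict ℚ L).range => G n)
    (hadd : ∀ a ∈ (absGaloisRestrict ℚ L).range, ∀ b ∈ (absGaloisRestrict ℚ L).range, G (a * b) = G a + G b)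
    (hconj : ∀ g, ∀ n ∈ (absGaloisRestrict ℚ L).range, G (g * n * g⁻¹) = (r g : ZMod p) * G n)
    (hI : ∀ (ℓ : HeightOneSpectrum (𝓞 ℚ)) (𝔓 : Ideal (absIntegers (𝓞 ℚ) ℚ)), 𝔓 ∈ ℓ.primesAbove →
      ∀ n ∈ (absGaloisRestrict ℚ L).range, n ∈ 𝔓.inertia (absoluteGaloisGroup ℚ) → G n = 0) :
    ∀ n ∈ (absGaloisRestrict ℚ L).range, G n = 0 := by
  haveI : NeZero ψ.conductor := ⟨ψ.conductor_ne_zero⟩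
  let φ : absoluteGaloisGroup ℚ →* ℤ_[p]ˣ := (Kato2004.teichmullerChar p).comp r
  have hφ : ∀ τ, φ τ = Kato2004.teichmullerChar p (r τ) := fun τ => rfl
  have hφL : ∀ σ : absoluteGaloisGroup L, φ (absGaloisRestrict ℚ L σ) = 1 := fun σ => by
    rw [hφ, hrL, map_one]
  have hr : ∀ τ : absoluteGaloisGroup ℚ, PadicInt.toZMod ((φ τ : ℤ_[p]ˣ) : ℤ_[p]) = ((r τ : (ZMod p)ˣ) : ZMod p) :=
    fun τ => by rw [hφ, Kato2004.toZMod_teichmullerChar]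
  have hdvd := ψ.conductor_dvd_level
  have hψχ : ∀ u : (ZMod m)ˣ, ψ (u : ZMod m) = ψ.primitiveCharacter ((ZMod.unitsMap hdvd u : (ZMod ψ.conductor)ˣ) :
      ZMod ψ.conductor) := fun u => by
    conv_lhs => rw [← DirichletCharacter.changeLevel_primitiveCharacter ψ]
    rw [DirichletCharacter.changeLevel_eq_cast_of_dvd _ hdvd, ZMod.unitsMap_def, Units.coe_map, MonoidHom.coe_coe,
      ZMod.castHom_apply]
  have hprim : ψ.primitiveCharacter.IsPrimitive := DirichletCharacter.primitiveCharacter_isPrimitive ψ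
  have hodd' : ψ.primitiveCharacter.Odd := by
    have h := hψχ (-1)
    rw [ZMod.unitsMap_def, Units.map_neg_one, Units.val_neg, Units.val_one, Units.val_neg, Units.val_one] at h
    rw [DirichletCharacter.Odd, ← h]
    exact hodd
  have hφχ : ∀ τ : absoluteGaloisGroup ℚ, (((φ τ : ℤ_[p]ˣ) : ℤ_[p]) : ℚ_[p]) =
      ψ.primitiveCharacter ((modNCyclotomicCharacter ℚ ψ.conductor τ : (ZMod ψ.conductor)ˣ) : ZMod ψ.conductor) :=
    fun τ => by rw [hφ, ← hψ τ, hψχ, Mazur1978.unitsMap_modNCyclotomicCharacter hdvd]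
  have hB' : ‖KrizLi2019.bernoulliOnePrim ψ.primitiveCharacter⁻¹‖ = 1 := by
    rw [← RegularLocusBernoulliPair.bernoulliOnePrim_changeLevel hdvd, map_inv,
      DirichletCharacter.changeLevel_primitiveCharacter]
    exact hB
  exact oddVanish_range_final_unconditional hp2 hpL hprim hodd' φ hφL hφχ hB' r hr G hGc hadd hconj hI

end Final

end Summit.BirchSwinnertonDyer.BirchSwinnertonDyer.Theorems.PrintCFram.HerbrandOddClassGroup

end
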